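import Literature.NumberTheory.NumberFields.KurodaRelationSymmetricThreeAmbiguous
import Literature.NumberTheory.NumberFields.ClassGroupCoprimeGaloisDescentCongruence
import Literature.NumberTheory.NumberFields.DihedralUnitCohomologyComparison
import Literature.NumberTheory.NumberFields.DihedralRamifiedPrimesComparison
import Literature.NumberTheory.GaloisRepresentations.UnitsHerbrand
import HarnessLib

/-!
# `S₃`-extensions: the group `⟨σ, τ⟩`, the `τ`-fixed `σ`-fixed `2`-power torsion classes of `L` versus the
# `δ`-fixed classes of the resolvent field `L^σ`, and Chevalley's count in the form `#C^G · #H¹(E) = h · ∏e · [E ∩ N : N E]`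

Topic `NumberTheory/NumberFields`; namespace `Literature.NumberTheory.NumberFields.KurodaSymmetricThree`.
THEOREM-ONLY file (no definition, no named fact, no `sorry`), written by the prover seat `bsd-line-att-p4` g30
(cell `bsd-f1-sign2`, `--supports` stmt-BirchSwinnertonDyer-22298; closes nothing; BSD is proved for no curve).
Preliminaries for `KurodaRelationSymmetricThreeExact.lean` (the exact `2`-part of the `S₃` class number
relation, Caputo–Nuccio 2020 Prop. 3.12 / Walter 1979 / Bartel 2012 Cor. 5.2):

* §1 (group theory) `exists_pow_mul_pow_of_mem_closure`, `card_closure_eq_six`, `conj_mem_zpowers_of_mem_closure`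
  — for `σ³ = 1 ≠ σ`, `τ² = 1`, `τσ = σ²τ`: `⟨σ,τ⟩ = {σⁱτʲ}` has order `6` and normalises `⟨σ⟩`.
* §2 `natCard_torsion_fixed_fixed_eq` — for `L/k` Galois, `σ, τ ∈ Gal(L/k)`, `R = L^σ` of odd index with
  `τ|_R = δ`: **`#{c ∈ Cl(L)[2^m] : σc = c, τc = c} = #{d ∈ Cl(R)[2^m] : δd = d}`** (the tree's coprime
  descent `KurodaOddPart.card_torsion_fixed_eq_card_torsion_fixedField`, Neukirch III (1.6), refined by the
  equivariance `i_{L/R}(δ d) = τ · i_{L/R}(d)` and injectivity of `i_{L/R}` on `2`-power torsion).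
* §3 `card_fixed_mul_h1_unitsE_eq` — Lang's steps (1)–(4) of Chevalley's formula recombined WITHOUT the unit
  Herbrand quotient: **`#Cl(L)^G · #H¹(G, E_L) = h_K · ∏_𝔭 e_𝔭 · [E_K ∩ N Lˣ : N E_L]`** for `L/K` cyclic, with
  `#H¹(G, E_L) ≠ 0` (`h1_unitsE_ne_zero`); §4 `natCard_torsion_fixed_eq_two_pow` — the `2^m`-torsion of the
  ambiguous classes counts `2^{v₂ #Cl(L)^G}`.

References: [CaputoNuccio2020] Prop. 3.12, Lemma 2.6; [NeukirchANT1999] Ch. III §1 Prop. (1.6) (ii), (iv);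
[Lang1990] Ch. 13 §4 Lemma 4.1 and its proof, steps (1)–(4); [Washington1997] §10.1.
-/

noncomputable section

open scoped NumberField Classical

namespace Literature.NumberTheory.NumberFields.KurodaSymmetricThree

open NumberField IsDedekindDomain Literature.NumberTheory.NumberFields
  Literature.NumberTheory.NumberFields.AmbiguousClass Literature.NumberTheory.GaloisRepresentations
  Literature.NumberTheory.GaloisRepresentations.Herbrand Literature.NumberTheory.GaloisRepresentations.MinkowskiUnit
  Literature.NumberTheory.GaloisRepresentations.CyclicNormIndex

/-! ### §1 The group `⟨σ, τ⟩ ≅ S₃` -/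

section Group

variable {G : Type*} [Group G] {σ τ : G}

/-- `σⁿ = σ^{n mod 3}` when `σ³ = 1`. [cite: CaputoNuccio2020, §2 (`ρ^q = 1`)] -/
theorem pow_eq_pow_mod_three (hσ : σ ^ 3 = 1) (n : ℕ) : σ ^ n = σ ^ (n % 3) := by
  conv_lhs => rw [← Nat.div_add_mod n 3, pow_add, pow_mul, hσ, one_pow, one_mul]

/-- An element of `⟨g⟩` with `g² = 1` is `1` or `g`. [cite: Lang1990, Ch. 13 §4 (cyclic group of prime order)] -/
theorem eq_one_or_eq_of_mem_zpowers {g h : G} (hg2 : g ^ 2 = 1) (hh : h ∈ Subgroup.zpowers g) : h = 1 ∨ h = g := by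
  obtain ⟨n, rfl⟩ := Subgroup.mem_zpowers_iff.mp hh
  rcases Int.even_or_odd n with ⟨m, rfl⟩ | ⟨m, rfl⟩
  · left
    rw [← two_mul, zpow_mul, show (g ^ (2 : ℤ)) = g ^ 2 from zpow_ofNat g 2, hg2, one_zpow]
  · right
    rw [zpow_add, zpow_mul, show (g ^ (2 : ℤ)) = g ^ 2 from zpow_ofNat g 2, hg2, one_zpow, one_mul, zpow_one]

/-- `τ ∉ ⟨σ⟩` for `σ³ = 1`, `τ² = 1 ≠ τ`. [cite: CaputoNuccio2020, §2 (`Σ ∩ G = 1`)] -/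
theorem not_mem_zpowers_of_orders (hσ : σ ^ 3 = 1) (hτ : τ ^ 2 = 1) (hτ1 : τ ≠ 1) : τ ∉ Subgroup.zpowers σ := by
  intro h
  obtain ⟨n, hn⟩ := Subgroup.mem_zpowers_iff.mp h
  have h3 : τ ^ 3 = 1 := by
    rw [← hn, ← zpow_natCast, ← zpow_mul, mul_comm, zpow_mul, zpow_natCast, hσ, one_zpow]
  apply hτ1
  calc τ = τ ^ 3 * (τ ^ 2)⁻¹ := by group
    _ = 1 := by rw [h3, hτ, inv_one, one_mul]

/-- If `σ ≠ 1` then `τ ≠ 1` (else `σ = σ²`). [cite: CaputoNuccio2020, §2] -/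
theorem tau_ne_one (hσ : σ ^ 3 = 1) (hτσ : τ * σ = σ ^ 2 * τ) (hσ1 : σ ≠ 1) : τ ≠ 1 := by
  rintro rfl
  rw [one_mul, mul_one] at hτσ
  apply hσ1
  have h2 : σ ^ 2 = 1 := by
    calc σ ^ 2 = σ * σ := pow_two σ
      _ = σ * σ ^ 2 := by rw [← hτσ]
      _ = 1 := by rw [← pow_succ', hσ]
  rw [hτσ, h2]

/-- **`⟨σ, τ⟩ = {σⁱ τʲ : i < 3, j < 2}`.** [cite: CaputoNuccio2020, §2 (the dihedral group `D`)] -/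
theorem exists_pow_mul_pow_of_mem_closure (hσ : σ ^ 3 = 1) (hτ : τ ^ 2 = 1) (hτσ : τ * σ = σ ^ 2 * τ)
    {g : G} (hg : g ∈ Subgroup.closure ({σ, τ} : Set G)) : ∃ i j : ℕ, i < 3 ∧ j < 2 ∧ g = σ ^ i * τ ^ j := by
  have hτinv : τ⁻¹ = τ := by rw [inv_eq_iff_mul_eq_one, ← pow_two, hτ]
  -- normal form of a product `σ^a τ^b`, any `a b`
  -- `τσⁿ = σ²ⁿτ` (the landed `DihedralPrimes.tau_mul_sigma_pow` is the Galois-group special case)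
  have tau_mul_pow : ∀ n : ℕ, τ * σ ^ n = σ ^ (2 * n) * τ := fun n => by
    induction n with
    | zero => simp
    | succ n ih => rw [pow_succ, ← mul_assoc, ih, mul_assoc, hτσ, ← mul_assoc, ← pow_add, Nat.mul_succ]
  have nf : ∀ a b : ℕ, ∃ i j : ℕ, i < 3 ∧ j < 2 ∧ σ ^ a * τ ^ b = σ ^ i * τ ^ j := fun a b =>
    ⟨a % 3, b % 2, Nat.mod_lt _ (by norm_num), Nat.mod_lt _ (by norm_num), by
      rw [← pow_eq_pow_mod_three hσ]
      conv_lhs => rw [← Nat.div_add_mod b 2, pow_add, pow_mul, hτ, one_pow, one_mul]⟩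
  induction hg using Subgroup.closure_induction with
  | mem y hy =>
    rcases hy with rfl | rfl
    · exact ⟨1, 0, by norm_num, by norm_num, by simp⟩
    · exact ⟨0, 1, by norm_num, by norm_num, by simp⟩
  | one => exact ⟨0, 0, by norm_num, by norm_num, by simp⟩
  | mul x y _ _ hx hy =>
    obtain ⟨i, j, -, hj, rfl⟩ := hx
    obtain ⟨i', j', -, -, rfl⟩ := hy
    obtain ⟨a, b, ha, hb, h⟩ := nf (i + 2 ^ j * i') (j + j')
    refine ⟨a, b, ha, hb, ?_⟩
    rw [← h]
    interval_cases j
    · rw [pow_zero, pow_zero, one_mul, zero_add, mul_one, ← mul_assoc, ← pow_add]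
    · rw [pow_one, pow_one, mul_assoc, ← mul_assoc τ, tau_mul_pow, mul_assoc (σ ^ (2 * i')),
        ← mul_assoc (σ ^ i), ← pow_add, ← pow_succ', add_comm j' 1]
  | inv x _ hx =>
    obtain ⟨i, j, -, hj, rfl⟩ := hx
    have hi3 : σ ^ i * σ ^ (2 * i) = 1 := by
      rw [← pow_add, show i + 2 * i = 3 * i by ring, pow_mul, hσ, one_pow]
    interval_cases j
    · obtain ⟨a, b, ha, hb, h⟩ := nf (2 * i) 0
      refine ⟨a, b, ha, hb, ?_⟩
      rw [← h]
      simp only [pow_zero, mul_one]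
      exact inv_eq_of_mul_eq_one_right hi3
    · obtain ⟨a, b, ha, hb, h⟩ := nf i 1
      refine ⟨a, b, ha, hb, ?_⟩
      rw [← h, pow_one, mul_inv_rev, hτinv, inv_eq_of_mul_eq_one_right hi3, tau_mul_pow,
        pow_eq_pow_mod_three hσ (2 * (2 * i)), pow_eq_pow_mod_three hσ i]
      congr 2
      omega

/-- **`#⟨σ, τ⟩ = 6`** for `σ³ = 1 ≠ σ`, `τ² = 1`, `τσ = σ²τ`. [cite: CaputoNuccio2020, §2 (the dihedral group `D`)] -/
theorem card_closure_eq_six (hσ : σ ^ 3 = 1) (hτ : τ ^ 2 = 1) (hτσ : τ * σ = σ ^ 2 * τ) (hσ1 : σ ≠ 1) :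
    Nat.card (Subgroup.closure ({σ, τ} : Set G)) = 6 := by
  set D := Subgroup.closure ({σ, τ} : Set G)
  have hσD : σ ∈ D := Subgroup.subset_closure (by simp)
  have hτD : τ ∈ D := Subgroup.subset_closure (by simp)
  -- `#D ≤ 6`
  haveI : Finite D := by
    refine Finite.of_surjective (fun p : Fin 3 × Fin 2 => (⟨σ ^ (p.1 : ℕ) * τ ^ (p.2 : ℕ),
      Subgroup.mul_mem _ (Subgroup.pow_mem _ hσD _) (Subgroup.pow_mem _ hτD _)⟩ : D)) ?_
    rintro ⟨g, hg⟩
    obtain ⟨i, j, hi, hj, rfl⟩ := exists_pow_mul_pow_of_mem_closure hσ hτ hτσ hg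
    exact ⟨(⟨i, hi⟩, ⟨j, hj⟩), rfl⟩
  have hle : Nat.card D ≤ 6 := by
    have h := Nat.card_le_card_of_surjective (fun p : Fin 3 × Fin 2 => (⟨σ ^ (p.1 : ℕ) * τ ^ (p.2 : ℕ),
      Subgroup.mul_mem _ (Subgroup.pow_mem _ hσD _) (Subgroup.pow_mem _ hτD _)⟩ : D)) ?_
    · simpa using h
    · rintro ⟨g, hg⟩
      obtain ⟨i, j, hi, hj, rfl⟩ := exists_pow_mul_pow_of_mem_closure hσ hτ hτσ hg
      exact ⟨(⟨i, hi⟩, ⟨j, hj⟩), rfl⟩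
  -- `6 ∣ #D`
  have h3 : 3 ∣ Nat.card D := by
    rw [← orderOf_eq_prime hσ hσ1, ← Nat.card_zpowers]
    exact Subgroup.card_dvd_of_le ((Subgroup.zpowers_le (G := G)).mpr hσD)
  have h2 : 2 ∣ Nat.card D := by
    rw [← orderOf_eq_prime hτ (tau_ne_one hσ hτσ hσ1), ← Nat.card_zpowers]
    exact Subgroup.card_dvd_of_le ((Subgroup.zpowers_le (G := G)).mpr hτD)
  have h6 : 6 ∣ Nat.card D := Nat.Coprime.mul_dvd_of_dvd_of_dvd (by norm_num) h2 h3
  have hpos : 0 < Nat.card D := Nat.card_pos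
  exact le_antisymm hle (Nat.le_of_dvd hpos h6)

/-- `⟨σ, τ⟩` normalises `⟨σ⟩`: `g n g⁻¹ ∈ ⟨σ⟩` for `g ∈ ⟨σ,τ⟩`, `n ∈ ⟨σ⟩` (`τ σ τ⁻¹ = σ⁻¹`).
[cite: CaputoNuccio2020, §2 (`G ◁ D`)] -/
theorem conj_mem_zpowers_of_mem_closure (hσ : σ ^ 3 = 1) (hτ : τ ^ 2 = 1) (hτσ : τ * σ = σ ^ 2 * τ)
    {g n : G} (hg : g ∈ Subgroup.closure ({σ, τ} : Set G)) (hn : n ∈ Subgroup.zpowers σ) :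
    g * n * g⁻¹ ∈ Subgroup.zpowers σ := by
  obtain ⟨i, j, -, hj, rfl⟩ := exists_pow_mul_pow_of_mem_closure hσ hτ hτσ hg
  obtain ⟨m, rfl⟩ := Subgroup.mem_zpowers_iff.mp hn
  have hτinv : τ⁻¹ = τ := by rw [inv_eq_iff_mul_eq_one, ← pow_two, hτ]
  -- `τ σ^m τ⁻¹ = σ^{-m}`
  have hconj : τ * σ ^ m * τ⁻¹ = (σ ^ m)⁻¹ := by
    have h1 : τ * σ * τ⁻¹ = σ⁻¹ := by
      rw [hτσ, mul_assoc, mul_inv_cancel, mul_one]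
      exact eq_inv_of_mul_eq_one_left (by rw [← pow_succ, hσ])
    calc τ * σ ^ m * τ⁻¹ = (MulAut.conj τ) (σ ^ m) := rfl
      _ = ((MulAut.conj τ) σ) ^ m := map_zpow _ _ _
      _ = (σ ^ m)⁻¹ := by rw [show (MulAut.conj τ) σ = τ * σ * τ⁻¹ from rfl, h1, inv_zpow]
  interval_cases j
  · rw [pow_zero, mul_one, (((Commute.refl σ).pow_left i).zpow_right m).eq, mul_assoc, mul_inv_cancel, mul_one]
    exact Subgroup.zpow_mem_zpowers σ m
  · rw [pow_one, mul_inv_rev, hτinv, show σ ^ i * τ * σ ^ m * (τ * (σ ^ i)⁻¹) =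
      σ ^ i * (τ * σ ^ m * τ⁻¹) * (σ ^ i)⁻¹ by rw [hτinv]; group, hconj]
    have hc : Commute (σ ^ i) (σ ^ m)⁻¹ := (((Commute.refl σ).pow_left i).zpow_right m).inv_right
    rw [hc.eq, mul_assoc, mul_inv_cancel, mul_one]
    exact Subgroup.inv_mem _ (Subgroup.zpow_mem_zpowers σ m)

end Group

/-! ### §2 `2`-power torsion classes: `σ,τ`-fixed in `Cl(L)` versus `δ`-fixed in `Cl(L^σ)` -/

section Descent

variable (k L : Type) [Field k] [NumberField k] [Field L] [NumberField L] [Algebra k L] [IsGalois k L]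

omit [NumberField k] [IsGalois k L] in
/-- **Equivariance of extension of ideals: `i_{L/R}(δ d) = τ · i_{L/R}(d)`** when `τ|_R = δ`
(`τ(𝔞𝓞_L) = (δ𝔞)𝓞_L`). [cite: NeukirchANT1999, Ch. III §1 Prop. (1.6) (iv)] -/
theorem mulEquiv_intAut_classGroupExtend {k' R : Type} [Field k'] [Field R] [NumberField R] [Algebra k' R]
    [Algebra R L] (τ : L ≃ₐ[k] L) (δ : R ≃ₐ[k'] R) (hδ : ∀ y, algebraMap R L (δ y) = τ (algebraMap R L y))
    (d : ClassGroup (𝓞 R)) :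
    ClassGroup.mulEquiv (intAut τ) (classGroupExtend R L d) = classGroupExtend R L (ClassGroup.mulEquiv (intAut δ) d) := by
  obtain ⟨I, rfl⟩ := ClassGroup.mk0_surjective d
  rw [classGroupExtend_mk0, AmbiguousClass.mulEquiv_mk0, AmbiguousClass.mulEquiv_mk0, classGroupExtend_mk0]
  congr 1
  apply Subtype.ext
  change ((I : Ideal (𝓞 R)).map (algebraMap (𝓞 R) (𝓞 L))).map (intAut τ : 𝓞 L →+* 𝓞 L) =
    ((I : Ideal (𝓞 R)).map (intAut δ : 𝓞 R →+* 𝓞 R)).map (algebraMap (𝓞 R) (𝓞 L))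
  rw [Ideal.map_map, Ideal.map_map]
  congr 1
  ext y
  exact (hδ y).symm

/-- **`#{c ∈ Cl(L)[2^m] : σc = c, τc = c} = #{d ∈ Cl(L^σ)[2^m] : δd = d}`** for `L/k` Galois,
`σ, τ ∈ Gal(L/k)`, `[L : L^σ]` odd, `δ = τ|_{L^σ}` an automorphism of `L^σ`: extension of ideals is a
bijection from the `2^m`-torsion of `Cl(L^σ)` onto the `σ`-fixed `2^m`-torsion of `Cl(L)` (Neukirch III
(1.6); tree `KurodaOddPart.card_torsion_fixed_eq_card_torsion_fixedField`) intertwining `δ` and `τ`.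
[cite: NeukirchANT1999, Ch. III §1 Prop. (1.6) (ii), (iv)] [cite: CaputoNuccio2020, Prop. 3.12 (`Cl_L^G ≅ Cl_F`)] -/
theorem natCard_torsion_fixed_fixed_eq (σ τ : L ≃ₐ[k] L)
    (hodd : ¬ 2 ∣ Module.finrank ↥(IntermediateField.fixedField (Subgroup.zpowers σ)) L)
    (δ : ↥(IntermediateField.fixedField (Subgroup.zpowers σ)) ≃ₐ[k] ↥(IntermediateField.fixedField (Subgroup.zpowers σ)))
    (hδ : ∀ y, algebraMap _ L (δ y) = τ (algebraMap _ L y)) (m : ℕ) :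
    Nat.card {c : ClassGroup (𝓞 L) // c ^ 2 ^ m = 1 ∧ ClassGroup.mulEquiv (intAut σ) c = c ∧
        ClassGroup.mulEquiv (intAut τ) c = c} =
      Nat.card {d : ClassGroup (𝓞 ↥(IntermediateField.fixedField (Subgroup.zpowers σ))) //
        d ^ 2 ^ m = 1 ∧ ClassGroup.mulEquiv (intAut δ) d = d} := by
  classical
  haveI : FiniteDimensional k L := Module.Finite.of_restrictScalars_finite ℚ k L
  have hcop : Nat.Coprime (Module.finrank ↥(IntermediateField.fixedField (Subgroup.zpowers σ)) L) (2 ^ m) :=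
    Nat.Coprime.pow_right m ((Nat.Prime.coprime_iff_not_dvd Nat.prime_two).mpr hodd).symm
  -- the coprime descent count of the tree
  have hN := KurodaOddPart.card_torsion_fixed_eq_card_torsion_fixedField k L (Subgroup.zpowers σ) hcop
  -- extension of ideals is injective on `2`-power torsion
  have hinj := classGroupExtend_injOn_pow_eq_one (K := ↥(IntermediateField.fixedField (Subgroup.zpowers σ)))
    (L := L) Nat.prime_two hodd
  have hmemT : ∀ {d : ClassGroup (𝓞 ↥(IntermediateField.fixedField (Subgroup.zpowers σ)))}, d ^ 2 ^ m = 1 →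
      d ∈ {c : ClassGroup (𝓞 ↥(IntermediateField.fixedField (Subgroup.zpowers σ))) | ∃ k : ℕ, c ^ 2 ^ k = 1} :=
    fun hd => ⟨m, hd⟩
  have hfixσ : ∀ d : ClassGroup (𝓞 ↥(IntermediateField.fixedField (Subgroup.zpowers σ))), ∀ g ∈ Subgroup.zpowers σ,
      ClassGroup.mulEquiv (intAut g) (classGroupExtend _ L d) = classGroupExtend _ L d := by
    intro d g hg
    have hg' : g ∈ IntermediateField.fixingSubgroup (IntermediateField.fixedField (Subgroup.zpowers σ)) := by
      rw [IntermediateField.fixingSubgroup_fixedField]; exact hg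
    let g' : L ≃ₐ[↥(IntermediateField.fixedField (Subgroup.zpowers σ))] L := { g with commutes' := fun x => hg' x }
    have : g'.restrictScalars k = g := by ext; rfl
    rw [← this]
    exact KurodaOddPart.galois_smul_classGroupExtend k L _ g' d
  -- the injective map on `2^m`-torsion is a bijection onto the `σ`-fixed `2^m`-torsion (equal counts)
  let f : {d : ClassGroup (𝓞 ↥(IntermediateField.fixedField (Subgroup.zpowers σ))) // d ^ 2 ^ m = 1} →
      {c : ClassGroup (𝓞 L) // c ^ 2 ^ m = 1 ∧ ∀ g ∈ Subgroup.zpowers σ, ClassGroup.mulEquiv (intAut g) c = c} :=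
    fun d => ⟨classGroupExtend _ L d.1, by rw [← map_pow, d.2, map_one], hfixσ d.1⟩
  have hf_inj : Function.Injective f := by
    rintro ⟨d₁, hd₁⟩ ⟨d₂, hd₂⟩ h
    exact Subtype.ext (hinj (hmemT hd₁) (hmemT hd₂) (congrArg (fun c => c.1) h))
  have hf_bij : Function.Bijective f := hf_inj.bijective_of_nat_card_le (le_of_eq hN)
  -- restrict to `δ`-fixed / `τ`-fixed classes
  symm
  refine Nat.card_congr (Equiv.ofBijective (fun d => (⟨classGroupExtend _ L d.1, by rw [← map_pow, d.2.1, map_one],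
      hfixσ d.1 σ (Subgroup.mem_zpowers σ), by rw [mulEquiv_intAut_classGroupExtend k L τ δ hδ, d.2.2]⟩ :
      {c : ClassGroup (𝓞 L) // c ^ 2 ^ m = 1 ∧ ClassGroup.mulEquiv (intAut σ) c = c ∧
        ClassGroup.mulEquiv (intAut τ) c = c})) ⟨?_, ?_⟩)
  · rintro ⟨d₁, hd₁⟩ ⟨d₂, hd₂⟩ h
    exact Subtype.ext (hinj (hmemT hd₁.1) (hmemT hd₂.1) (congrArg (fun c => c.1) h))
  · rintro ⟨c, hc, hσc, hτc⟩
    obtain ⟨⟨d, hd⟩, hdc⟩ := hf_bij.2 ⟨c, hc, forall_mem_zpowers_smul_eq k L hσc⟩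
    have hdc' : classGroupExtend _ L d = c := congrArg (fun c => c.1) hdc
    refine ⟨⟨d, hd, ?_⟩, Subtype.ext hdc'⟩
    apply hinj (hmemT (by rw [← map_pow, hd, map_one])) (hmemT hd)
    rw [← mulEquiv_intAut_classGroupExtend k L τ δ hδ, hdc', hτc]

end Descent

/-! ### §3 Chevalley's count without the unit Herbrand quotient -/

section Chevalley

variable {K L : Type} [Field K] [NumberField K] [Field L] [NumberField L] [Algebra K L] [IsGalois K L]

/-- **`#Cl(L)^G · #H¹(G, E_L) = h_K · ∏_𝔭 e_𝔭 · [E_K ∩ N_{L/K} Lˣ : N_{L/K} E_L]`** for a cyclic extension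
`L/K` with `G = ⟨σ⟩` — Lang's steps (1) `#C^G = [I^G : P^G]·#H¹(P_L)`, (2) `[I^G : ιP_K] = h_K ∏e_𝔭`,
(3) `[P^G : ιP_K] = #H¹(E_L)`, (4) `#H¹(P_L) = [E_K ∩ N Lˣ : N E_L]` recombined (the tree's
`AmbiguousClassIndexFormula.lean`), BEFORE the archimedean Herbrand quotient enters.
[cite: Lang1990, Ch. 13 §4, proof of Lemma 4.1, steps (1)–(4)] -/
theorem card_fixed_mul_h1_unitsE_eq {σ : L ≃ₐ[K] L} (hσ : ∀ τ : L ≃ₐ[K] L, τ ∈ Subgroup.zpowers σ) :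
    Nat.card {c : ClassGroup (𝓞 L) // ∀ τ : L ≃ₐ[K] L, ClassGroup.mulEquiv (intAut τ) c = c} *
        h1 σ (unitsE L) ⊥ =
      NumberField.classNumber K * (∏ᶠ v : HeightOneSpectrum (𝓞 K), v.asIdeal.ramificationIdxIn (𝓞 L)) *
        ((unitsE L).map (Herbrand.norm (L ≃ₐ[K] L))).relIndex
          (unitsE L ⊓ (⊤ : Subgroup Lˣ).map (Herbrand.norm (L ≃ₐ[K] L))) := by
  rw [card_fixed_eq_relIndex_mul_h1 hσ, h1_principals_eq_relIndex hσ, ← relIndex_map_principals_z0_top_eq_mul hσ,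
    relIndex_map_principals_z0_top_eq hσ]
  ring

/-- `#H¹(G, E_L) ≠ 0` (Herbrand's unit theorem). [cite: Lang1990, Ch. 13 §4 Lemma 4.1 (the units' Herbrand quotient)] -/
theorem h1_unitsE_ne_zero {σ : L ≃ₐ[K] L} (hσ : ∀ τ : L ≃ₐ[K] L, τ ∈ Subgroup.zpowers σ) :
    h1 σ (unitsE L) ⊥ ≠ 0 := by
  haveI : FiniteDimensional K L := Module.Finite.of_restrictScalars_finite ℚ K L
  exact (card_mul_h0_unitsE_eq (F := K) (E := L) hσ).2

/-! ### §4 The `2`-part of the number of ambiguous classes -/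

omit [NumberField K] [IsGalois K L] in
/-- **The `2^m`-torsion of the ambiguous classes counts `2^{v₂ #Cl(L)^G}`** (`m` large): the classes fixed
by `G = ⟨σ⟩` form a subgroup, whose `2`-Sylow subgroup is its `2^m`-torsion.
[cite: Washington1997, §10.1 (the `p`-part of the class group)] [cite: Lang1990, Ch. 13 §4 (ambiguous classes)] -/
theorem natCard_torsion_fixed_eq_two_pow {σ : L ≃ₐ[K] L} (hσ : ∀ τ : L ≃ₐ[K] L, τ ∈ Subgroup.zpowers σ)
    {m : ℕ} (hm : padicValNat 2 (Nat.card {c : ClassGroup (𝓞 L) //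
      ∀ τ : L ≃ₐ[K] L, ClassGroup.mulEquiv (intAut τ) c = c}) ≤ m) :
    Nat.card {c : ClassGroup (𝓞 L) // c ^ 2 ^ m = 1 ∧ ClassGroup.mulEquiv (intAut σ) c = c} =
      2 ^ padicValNat 2 (Nat.card {c : ClassGroup (𝓞 L) //
        ∀ τ : L ≃ₐ[K] L, ClassGroup.mulEquiv (intAut τ) c = c}) := by
  classical
  obtain ⟨H, hH⟩ := isSubgroup_fixed (K := K) (L := L)
  have hmem : ∀ c, c ∈ H ↔ ∀ τ : L ≃ₐ[K] L, ClassGroup.mulEquiv (intAut τ) c = c := fun c => by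
    rw [← SetLike.mem_coe, hH]; rfl
  have hcard : Nat.card {c : ClassGroup (𝓞 L) // ∀ τ : L ≃ₐ[K] L, ClassGroup.mulEquiv (intAut τ) c = c} =
      Nat.card H := Nat.card_congr (Equiv.subtypeEquivRight fun c => (hmem c).symm)
  haveI : Fact (Nat.Prime 2) := ⟨Nat.prime_two⟩
  rw [hcard] at hm ⊢
  rw [← natCard_torsion_pow_eq_pow_padicValNat (M := H) hm]
  refine Nat.card_congr
    { toFun := fun c => ⟨⟨c.1, (hmem _).mpr fun τ' => forall_mem_zpowers_smul_eq K L c.2.2 τ' (hσ τ')⟩,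
        Subtype.ext (by simpa using c.2.1)⟩
      invFun := fun h => ⟨h.1.1, by simpa using congrArg Subtype.val h.2, ((hmem _).mp h.1.2) σ⟩
      left_inv := fun c => rfl
      right_inv := fun h => rfl }

end Chevalley

/-! ### §5 Transport helpers -/

section Transport

variable (F L : Type) [Field F] [NumberField F] [Field L] [NumberField L] [Algebra F L] [IsGalois F L]

omit [NumberField F] [IsGalois F L] in
/-- Isomorphic number fields have the same class number. [cite: NeukirchANT1999, Ch. I §6 (the class group is an invariant)] -/
theorem classNumber_eq_of_ringEquiv_aux {A B : Type} [Field A] [NumberField A] [Field B] [NumberField B]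
    (e : A ≃+* B) : NumberField.classNumber A = NumberField.classNumber B := by
  unfold NumberField.classNumber
  rw [← Nat.card_eq_fintype_card, ← Nat.card_eq_fintype_card]
  exact Nat.card_congr (ClassGroup.mulEquiv (NumberField.RingOfIntegers.mapRingEquiv e)).toEquiv

omit [NumberField F] [NumberField L] [IsGalois F L] in
/-- Two intermediate fields (over possibly different bases inside `L`) with the same elements are isomorphic.
[cite: NeukirchANT1999, Ch. I §6] -/
theorem nonempty_ringEquiv_of_forall_mem_iff {F' : Type} [Field F'] [Algebra F' L] (E : IntermediateField F L)
    (E' : IntermediateField F' L) (h : ∀ x : L, x ∈ E ↔ x ∈ E') : Nonempty (↥E ≃+* ↥E') :=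
  ⟨{ toFun := fun x => ⟨x.1, (h x.1).mp x.2⟩
     invFun := fun x => ⟨x.1, (h x.1).mpr x.2⟩
     left_inv := fun _ => rfl
     right_inv := fun _ => rfl
     map_mul' := fun _ _ => rfl
     map_add' := fun _ _ => rfl }⟩

omit [NumberField F] [NumberField L] [IsGalois F L] in
/-- `(σ₁ⁿ) x = (σⁿ) x` when `σ₁` acts as `σ`. [cite: CaputoNuccio2020, §2 (notation)] -/
theorem pow_apply_eq_pow_apply {F' : Type} [Field F'] [Algebra F' L] {σ₁ : L ≃ₐ[F'] L} {σ : L ≃ₐ[F] L}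
    (h : ∀ x, σ₁ x = σ x) (n : ℕ) (x : L) : (σ₁ ^ n) x = (σ ^ n) x := by
  induction n generalizing x with
  | zero => simp
  | succ n ih => rw [pow_succ, AlgEquiv.mul_apply, h, ih, ← AlgEquiv.mul_apply, ← pow_succ]

omit [NumberField F] [NumberField L] [IsGalois F L] in
/-- `x` is fixed by `⟨g⟩` iff it is fixed by `g`. [cite: Lang1990, Ch. 13 §4 (ambiguous = fixed by a generator)] -/
theorem forall_mem_zpowers_apply_eq_iff {F' : Type} [Field F'] [Algebra F' L] (g : L ≃ₐ[F'] L) (x : L) :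
    (∀ f ∈ Subgroup.zpowers g, f x = x) ↔ g x = x := by
  constructor
  · exact fun h => h g (Subgroup.mem_zpowers g)
  · intro hx f hf
    have hle : Subgroup.zpowers g ≤ MulAction.stabilizer (L ≃ₐ[F'] L) x :=
      (Subgroup.zpowers_le (G := L ≃ₐ[F'] L)).mpr hx
    exact hle hf

end Transport

end Literature.NumberTheory.NumberFields.KurodaSymmetricThree
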